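import Mathlib
import Summits.ResolutionOfSingularities.ResolutionOfSingularities.Theorems.WeightedInvariantLocalWeightedDropNCResSurfGraphShadow

/-!
# `WeightedInvariant.LocalWeightedDrop`: NC-resolution settings for the TOT₂ line — GRAPH SURFACES, part 23: THE CURVE MOVE EXPOSES ITS SUCCESSOR DATUM

Crux item stmt-ResolutionOfSingularities-8899 `LocalWeightedDrop` (route `ResolutionOfSingularities/WeightedInvariant`), ENGINE skeleton v34/v35, residual
`stub_wildWideApexFourStartsWon`; res-L1-w43-strat-1's line `directrix-cut` v3f, piece PL₃, sub-skeleton `pl3_split_v1` (7519a9009475ab47), stub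
`stub_apexPlaneSurfaceThree` = the SURFACE sub-case `ApexPlaneSurfaceExit`, reduced (…NCResSurfGraphRegime, p557720) to the loop `SurfLoop k m`.
Design memo `L/res-L1-w43-stub-4/g6/SURFLOOP-DESIGN.md`.  [OURS · L1 W4.3 · chain w43 · seat res-L1-w43-stub-4 gen 6; def-free, on parts 1–19 and 22
(…NCResSurfGraph*), res-L1-w43-stub-1's S-SET and res-L1-w43-lead-1's boundary bookkeeping (…NCResRegimeTransport); the count game is the programme's
own; nothing here is a statement of any manuscript; AI-produced, gate-checked, weaker than expert review.]

* `isBPermissible_curve`, `admissible_curveSucc`, `head_curveSucc_le`, `curve_tangent_of_head_eq` (part 13), `valid_curveSucc` (parts 11–14 with the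
  exceptional letter FIRST);
* the letters of the successor of the curve move along `S ∩ {x_a = 0}`: `mem_transform_E_curve_iff` (the partial shear fixes the boundary letters),
  `a_mem_E_curveSucc`, `b_mem_E_curveSucc_iff`, `mem_off_curveSucc_iff` / `off_curveSucc_eq_image`, and its traces `curveSucc_ψ_predAbove` =
  `ψ_l(λx₀, x₁)/x₀ − c_l`, `subst_ccb_ψ`.
-/

set_option linter.dupNamespace false -- mandated namespace of this single-conjunct summit

noncomputable section

namespace Summit.ResolutionOfSingularities.ResolutionOfSingularities.Theorems

namespace TameFourTupleDrop

namespace GraphSurf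

namespace SurfDatum

open MvPowerSeries Literature.AlgebraicGeometry.Resolution

variable {k : Type} [Field k] {m : ℕ}

/-- The weight convention of the curve move: `c_b = 0`. -/
theorem curve_conv {σ : SurfDatum k m} {c : Fin (m + 1) → k} (hc0 : ∀ l, σ.curveW l = 0 → c l = 0) : c σ.b = 0 :=
  hc0 σ.b (by simp [curveW])

/-- Off-base divisibility in the two spellings. -/
theorem hE_of_off {σ : SurfDatum k m} (hE : ∀ l ∈ σ.off, (X 0 : MvPowerSeries (Fin 2) k) ∣ σ.ψ l) :
    ∀ l ∈ σ.δ.E, ¬ (l = σ.a ∨ l = σ.b) → (X 0 : MvPowerSeries (Fin 2) k) ∣ σ.ψ l :=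
  fun l hl hlab => hE l ((mem_off_iff σ l).mpr ⟨hl, hlab⟩)

/-- The curve move is B-permissible (part 13). -/
theorem isBPermissible_curve {σ : SurfDatum k m} (hσ : σ.Valid) (hE : ∀ l ∈ σ.off, (X 0 : MvPowerSeries (Fin 2) k) ∣ σ.ψ l) :
    IsBPermissible σ.δ σ.curveΦ σ.curveW :=
  isBPermissible_partialShear hσ.1 hσ.2.1 hσ.2.2.1 (hE_of_off hE) hσ.2.2.2.1

/-- The successor of the curve move is admissibly decorated. -/
theorem admissible_curveSucc {σ : SurfDatum k m} (hσ : σ.Valid) (hE : ∀ l ∈ σ.off, (X 0 : MvPowerSeries (Fin 2) k) ∣ σ.ψ l)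
    {c : Fin (m + 1) → k} (hc0 : ∀ l, σ.curveW l = 0 → c l = 0) {A : ℕ} {G : MvPowerSeries (Fin (m + 1 + 1)) k}
    (hfac : subst (CobordantChart.chart σ.curveW c) (subst σ.curveΦ σ.b₀) = X 0 ^ A * G) (hG : ¬ X 0 ∣ G) (hca : c σ.a ≠ 0) :
    Admissible (σ.curveSucc c G).b₀ (σ.curveSucc c G).δ :=
  admissible_transform hσ.1 (isBPermissible_curve hσ hE) hc0 hfac hG hca

/-- The head does not rise along the curve move. -/
theorem head_curveSucc_le {σ : SurfDatum k m} (hσ : σ.Valid) (hE : ∀ l ∈ σ.off, (X 0 : MvPowerSeries (Fin 2) k) ∣ σ.ψ l)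
    {c : Fin (m + 1) → k} (hc0 : ∀ l, σ.curveW l = 0 → c l = 0) (G : MvPowerSeries (Fin (m + 1 + 1)) k) (hca : c σ.a ≠ 0) :
    (σ.curveSucc c G).δ.head ≤ σ.δ.head :=
  Decoration.head_transform_le (isBPermissible_curve hσ hE) hc0 hσ.1.2.1.ne_zero hca

/-- **AT A SAME-HEAD ANSWER OF THE CURVE MOVE THE ANSWER IS THE SURFACE DIRECTION** (part 13 re-packaged): `c = c_a · t_L` restricted to the
boundary traces, `c_a ≠ 0`. -/
theorem curve_tangent_of_head_eq [Infinite k] {σ : SurfDatum k m} (hσ : σ.Valid) (hE : ∀ l ∈ σ.off, (X 0 : MvPowerSeries (Fin 2) k) ∣ σ.ψ l)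
    {c : Fin (m + 1) → k} (hc0 : ∀ l, σ.curveW l = 0 → c l = 0) {i : Fin (m + 1)} (hci : c i ≠ 0)
    (hhead : (σ.δ.transform σ.curveΦ σ.curveW c i).head = σ.δ.head) :
    c = c σ.a • tangentL σ.a σ.b (fun j => if j ∈ σ.δ.E then σ.ψ j else 0) ∧ c σ.a ≠ 0 := by
  obtain ⟨hadm, hab, hψ, hperm, htwo⟩ := hσ
  have hf : σ.δ.f ≠ 0 := hadm.2.1.ne_zero
  obtain ⟨H, U, hfacH, hH, -, -⟩ := Decoration.totalO_chart_eq (isBPermissible_curve ⟨hadm, hab, hψ, hperm, htwo⟩ hE) hc0 hf hci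
  exact curveTangent_answer_of_head_eq hadm hab hψ (hE_of_off hE) hperm htwo (curve_conv hc0) hci hfacH hH hhead

/-- **THE SUCCESSOR OF THE CURVE MOVE IS A VALID LOOP STATE** (parts 11–14 re-packaged, exceptional letter first). -/
theorem valid_curveSucc [Infinite k] {σ : SurfDatum k m} (hσ : σ.Valid) (hE : ∀ l ∈ σ.off, (X 0 : MvPowerSeries (Fin 2) k) ∣ σ.ψ l)
    {c : Fin (m + 1) → k} (hc0 : ∀ l, σ.curveW l = 0 → c l = 0)
    (hc : c = c σ.a • tangentL σ.a σ.b (fun j => if j ∈ σ.δ.E then σ.ψ j else 0)) (hca : c σ.a ≠ 0)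
    {A : ℕ} {G : MvPowerSeries (Fin (m + 1 + 1)) k}
    (hfac : subst (CobordantChart.chart σ.curveW c) (subst σ.curveΦ σ.b₀) = X 0 ^ A * G) (hG : ¬ X 0 ∣ G)
    (hhead : (σ.curveSucc c G).δ.head = σ.δ.head) : (σ.curveSucc c G).Valid := by
  obtain ⟨hadm, hab, hψ, hperm, htwo⟩ := hσ
  have hcb := curve_conv hc0
  have hadm' := admissible_curveSucc ⟨hadm, hab, hψ, hperm, htwo⟩ hE hc0 hfac hG hca
  have hcE := (curve_answer_apply (a := σ.a) (b := σ.b) (ψ := σ.ψ) (E := σ.δ.E) hc).1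
  refine ⟨hadm', (predAbove_succ_ne_zero' hab).symm, ?_, ?_, ?_⟩
  · intro j hj
    rw [curveSucc_ψ, constantCoeff_swap]
    exact constantCoeff_curveStep_of_ne (b := σ.b) hcE j (fun h => hj (Or.comm.mp h))
  · have h := inOffPlaneIdeal_curveTransform hadm hab hψ (hE_of_off hE) hperm hc hca hcb hhead
    rw [shear_swap (Fin.predAbove σ.a σ.b.succ) 0] at h
    exact h.symm
  · exact apexPlane_curveTransform_of_head_eq hadm hab hψ (hE_of_off hE) hperm htwo hca hcb hhead hadm'

/-! ### Letters of the curve successor -/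

/-- The partial shear fixes every boundary letter. -/
theorem curveΦ_of_mem_E {σ : SurfDatum k m} {l : Fin (m + 1)} (hl : l ∈ σ.δ.E) : σ.curveΦ l = X l := by
  rw [curveΦ]
  refine shear_eq_X_of_eq_zero ?_
  by_cases h : l = σ.a ∨ l = σ.b
  · exact Or.inl h
  · exact Or.inr (by simp [hl])

/-- THE BOUNDARY OF THE CURVE TRANSFORM: the exceptional letter and the through-going letters, re-indexed (as for the point move). -/
theorem mem_transform_E_curve_iff (σ : SurfDatum k m) (c : Fin (m + 1) → k) (i : Fin (m + 1)) (l' : Fin (m + 1)) :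
    l' ∈ (σ.δ.transform σ.curveΦ σ.curveW c i).E ↔ l' = 0 ∨ ∃ l ∈ σ.δ.E, c l = 0 ∧ Fin.predAbove i l.succ = l' := by
  classical
  rw [Decoration.transform_E, Finset.mem_insert]
  unfold Decoration.newLetters
  simp only [Finset.mem_image, Finset.mem_filter]
  constructor
  · rintro (h | ⟨l, ⟨hl, hc⟩, he⟩)
    · exact Or.inl h
    · rw [strIdx_of_apply_eq_X (curveΦ_of_mem_E hl)] at hc he
      exact Or.inr ⟨l, hl, hc, he⟩
  · rintro (h | ⟨l, hl, hc, he⟩)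
    · exact Or.inl h
    · refine Or.inr ⟨l, ⟨hl, ?_⟩, ?_⟩
      · rwa [strIdx_of_apply_eq_X (curveΦ_of_mem_E hl)]
      · rwa [strIdx_of_apply_eq_X (curveΦ_of_mem_E hl)]

/-- The exceptional letter is a boundary letter of the curve successor. -/
theorem a_mem_E_curveSucc (σ : SurfDatum k m) (c : Fin (m + 1) → k) (G : MvPowerSeries (Fin (m + 1 + 1)) k) :
    (σ.curveSucc c G).a ∈ (σ.curveSucc c G).δ.E :=
  (mem_transform_E_curve_iff σ c σ.a 0).mpr (Or.inl rfl)

/-- The second base letter of the curve successor is a boundary letter iff `b` was one (`c_b = 0` by the weight convention). -/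
theorem b_mem_E_curveSucc_iff {σ : SurfDatum k m} (hab : σ.a ≠ σ.b) {c : Fin (m + 1) → k} (hca : c σ.a ≠ 0) (hcb : c σ.b = 0)
    (G : MvPowerSeries (Fin (m + 1 + 1)) k) :
    (σ.curveSucc c G).b ∈ (σ.curveSucc c G).δ.E ↔ σ.b ∈ σ.δ.E := by
  rw [curveSucc_bLetter, curveSucc_δ, mem_transform_E_curve_iff]
  obtain ⟨q, hq, hpred⟩ := predAbove_succ_eq (Ne.symm hab)
  constructor
  · rintro (h | ⟨l, hl, hcl, he⟩)
    · rw [hpred] at h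
      exact absurd h (Fin.succ_ne_zero q)
    · have hla : l ≠ σ.a := fun h' => hca (h' ▸ hcl)
      rwa [← predAbove_succ_injOn hla (Ne.symm hab) he]
  · intro hb
    exact Or.inr ⟨σ.b, hb, hcb, rfl⟩

/-- THE OFF-BASE BOUNDARY LETTERS OF THE CURVE SUCCESSOR. -/
theorem mem_off_curveSucc_iff {σ : SurfDatum k m} (hab : σ.a ≠ σ.b) {c : Fin (m + 1) → k} (hca : c σ.a ≠ 0)
    (G : MvPowerSeries (Fin (m + 1 + 1)) k) (l' : Fin (m + 1)) :
    l' ∈ (σ.curveSucc c G).off ↔ ∃ l ∈ σ.off, c l = 0 ∧ Fin.predAbove σ.a l.succ = l' := by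
  rw [mem_off_iff, curveSucc_δ, curveSucc_a, curveSucc_bLetter, mem_transform_E_curve_iff]
  constructor
  · rintro ⟨h | ⟨l, hl, hcl, he⟩, hne⟩
    · exact absurd (Or.inl h) hne
    · have hla : l ≠ σ.a := fun h => hca (h ▸ hcl)
      refine ⟨l, (mem_off_iff σ l).mpr ⟨hl, ?_⟩, hcl, he⟩
      rintro (h | h)
      · exact hla h
      · apply hne
        right
        rw [← he, h]
  · rintro ⟨l, hl, hcl, he⟩
    obtain ⟨hlE, hlab⟩ := (mem_off_iff σ l).mp hl
    have hla : l ≠ σ.a := fun h => hlab (Or.inl h)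
    refine ⟨Or.inr ⟨l, hlE, hcl, he⟩, ?_⟩
    obtain ⟨q, rfl, hq⟩ := predAbove_succ_eq hla
    rintro (h | h)
    · rw [← he, hq] at h
      exact Fin.succ_ne_zero q h
    · rw [← he] at h
      exact hlab (Or.inr (predAbove_succ_injOn hla (Ne.symm hab) h))

open Classical in
/-- The off-base boundary letters of the curve successor, as an image. -/
theorem off_curveSucc_eq_image {σ : SurfDatum k m} (hab : σ.a ≠ σ.b) {c : Fin (m + 1) → k} (hca : c σ.a ≠ 0)
    (G : MvPowerSeries (Fin (m + 1 + 1)) k) :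
    (σ.curveSucc c G).off = (σ.off.filter fun l => c l = 0).image fun l => Fin.predAbove σ.a l.succ := by
  ext l'
  rw [mem_off_curveSucc_iff hab hca, Finset.mem_image]
  simp only [Finset.mem_filter]
  constructor
  · rintro ⟨l, hl, hcl, he⟩
    exact ⟨l, ⟨hl, hcl⟩, he⟩
  · rintro ⟨l, ⟨hl, hcl⟩, he⟩
    exact ⟨l, hl, hcl, he⟩

/-- THE TRACES OF THE CURVE SUCCESSOR at a re-indexed boundary letter: `ψ_l(λx₀, x₁)/x₀ − c_l` (part 11's curve-step series, variables exchanged). -/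
theorem curveSucc_ψ_predAbove (σ : SurfDatum k m) (c : Fin (m + 1) → k) (G : MvPowerSeries (Fin (m + 1 + 1)) k) {l : Fin (m + 1)}
    (hl : l ≠ σ.a) (hlE : l ∈ σ.δ.E) :
    (σ.curveSucc c G).ψ (Fin.predAbove σ.a l.succ) =
      subst (![X 1, X 0] : Fin 2 → MvPowerSeries (Fin 2) k) (curveStepSeries (σ.ψ l) (c σ.a) (c l)) := by
  obtain ⟨q, rfl, hq⟩ := predAbove_succ_eq hl
  rw [curveSucc_ψ, hq, curveStep_succ, if_pos hlE]

/-- The slot-`0` reading family of the curve move `(λ x₀, x₁)` may be substituted. -/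
theorem hasSubst_ccb (lam : k) : HasSubst (![C lam * X 0, X 1] : Fin 2 → MvPowerSeries (Fin 2) k) :=
  hasSubst_of_constantCoeff_zero fun t => by fin_cases t <;> simp [constantCoeff_X]

/-- **A BOUNDARY TRACE THROUGH THE CURVE MOVE**: `ψ_l(λx₀, x₁) = x₀ · ψ'_{l⁺} + c_l x₀` (`x₀ ∣ ψ_l`). -/
theorem subst_ccb_ψ {σ : SurfDatum k m} {c : Fin (m + 1) → k} (G : MvPowerSeries (Fin (m + 1 + 1)) k) {l : Fin (m + 1)}
    (hl : l ≠ σ.a) (hlE : l ∈ σ.δ.E) (hdiv : (X 0 : MvPowerSeries (Fin 2) k) ∣ σ.ψ l) :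
    subst (![C (c σ.a) * X 0, X 1] : Fin 2 → MvPowerSeries (Fin 2) k) (σ.ψ l) =
      X 0 * (σ.curveSucc c G).ψ (Fin.predAbove σ.a l.succ) + C (c l) * X 0 := by
  rw [curveSucc_ψ_predAbove σ c G hl hlE]
  have h := congrArg (subst (![X 1, X 0] : Fin 2 → MvPowerSeries (Fin 2) k)) (X_one_mul_curveStepSeries hdiv (c σ.a) (c l))
  rw [← coe_substAlgHom TOT2Curve.hasSubst_swap, map_mul, map_sub, map_mul, coe_substAlgHom,
    subst_comp_subst_apply (hasSubst_curveBase (c σ.a)) TOT2Curve.hasSubst_swap] at h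
  simp only [subst_X TOT2Curve.hasSubst_swap, subst_C, Matrix.cons_val_one, Matrix.cons_val_zero] at h
  have hfam : (fun t : Fin 2 => subst (![X 1, X 0] : Fin 2 → MvPowerSeries (Fin 2) k)
      ((![C (c σ.a) * X 1, X 0] : Fin 2 → MvPowerSeries (Fin 2) k) t)) =
      (![C (c σ.a) * X 0, X 1] : Fin 2 → MvPowerSeries (Fin 2) k) := by
    funext t
    fin_cases t
    · simp [subst_mul TOT2Curve.hasSubst_swap, subst_X TOT2Curve.hasSubst_swap, subst_C]
    · simp [subst_X TOT2Curve.hasSubst_swap]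
  rw [hfam] at h
  rw [← sub_eq_iff_eq_add]
  exact h.symm


end SurfDatum

end GraphSurf

end TameFourTupleDrop

end Summit.ResolutionOfSingularities.ResolutionOfSingularities.Theorems

end
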